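import Literature.AlgebraicGeometry.Resolution.AlterationsSectionDivisor
import Literature.AlgebraicGeometry.Resolution.StalkIdealLemmas
import Literature.AlgebraicGeometry.Resolution.QuasiExcellentSchemes
import Literature.AlgebraicGeometry.Resolution.MarkedIdealsLemmas
import HarnessLib

/-!
# Crux `PatchingRelPerfect` (stmt-ResolutionOfSingularities-16161), chain W5.2 — F7(β) (β-AX) X3 C-I, (T-g) THE SING BRIDGE `X ↔ G`:
# singular points of a closed subset of a closed subscheme, read on the ambient scheme

[OURS · L1 W5.2 · F7(β) (β-AX) X3 C-I (M2b-T) (T-g) · res-D-repro-1 AS res-L1-repro-3΄s `M2bT-ASSEMBLY-PLAN.md` §2 (hand res-D-pv-021 g9, TUO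
21:1xZ).]  Replaces the role of NO printed item; NOT a statement of the manuscript under review; fact-free.  AI-written; AI review is weaker than
expert review.  No definitions.

For a closed immersion `ι : S ↪ X` and a closed `T ⊆ X` lying ON `S` (`ker ι ≤ 𝓘_X(T)`, i.e. `T ⊆ ι(S)`):
* `comap_vanishingIdeal_of_isClosedImmersion_of_ker_le` — `𝓘_X(T)·𝒪_S = 𝓘_S(ι⁻¹T)` (the pulled-back ideal is radical because it is the image of a
  radical ideal containing the kernel under the surjections `𝒪_{X,ι z} → 𝒪_{S,z}`; FALSE without `ker ι ≤ 𝓘_X(T)`: `S = V(y)`, `T = V(y − x²)`).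
* `isRegularLocalRing_quot_comap_iff` — **`𝒪_{S,z} ⧸ 𝓘_S(ι⁻¹T)_z` is regular iff `𝒪_{X,ι z} ⧸ 𝓘_X(T)_{ι z}` is** (third isomorphism theorem:
  `𝒪_{S,z} = 𝒪_{X,ι z} ⧸ (ker ι)_{ι z}` and `(ker ι)_{ι z} ⊆ 𝓘_X(T)_{ι z}`).
* `isRegularLocalRing_stalk_subscheme_iff` — the local ring of the closed subscheme `V(C)` at `z` is regular iff `𝒪_{X,z} ⧸ C_z` is; whence
  `image_compl_regularLocus_subscheme` — **`V(C)_sing`, pushed into `X`, is `{y ∈ Supp C | 𝒪_{X,y} ⧸ C_y not regular}`**.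
Consumers: repro-3΄s `…ContactCure` assembly (turns (T-b′)΄s `T₀` on the carrier into `Sing(𝒳) ∪ (𝒳 ∩ B)` on the patch, where LEG applies).

## References
* The Stacks Project, Tag 01QN (closed immersions: surjective stalk maps), Tag 07R1 (regular locus). [StacksProject]
* U. Görtz, T. Wedhorn, *Algebraic Geometry I* (2nd ed., 2020), Prop. 3.31 / §3.9 (closed subschemes and their local rings). [GortzWedhorn2020]
-/

-- `Summit.<Summit>.<Sub>.Theorems` with `Sub = Summit` (single-conjunct summit, D-0017)
set_option linter.dupNamespace false

noncomputable section

open CategoryTheory AlgebraicGeometry TopologicalSpace IsLocalRing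
open Literature.AlgebraicGeometry.Resolution
open Scheme.IdealSheafData

namespace Summit.ResolutionOfSingularities.ResolutionOfSingularities.Theorems

namespace ContactRealisation

universe u

variable {S X : Scheme.{u}} (ι : S ⟶ X) [IsClosedImmersion ι]

/-! ## §1 Vanishing ideals pull back along a closed immersion onto which the closed set fits -/

/-- The stalks of a pulled-back vanishing ideal along a closed immersion whose kernel it contains are radical. [folklore] -/
theorem isRadical_stalkIdeal_comap_vanishingIdeal (T : Closeds X) (hT : ι.ker ≤ vanishingIdeal T) (z : S) :
    (stalkIdeal ((vanishingIdeal T).comap ι) z).IsRadical := by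
  have hφ : Function.Surjective (ι.stalkMap z).hom := ι.stalkMap_surjective z
  have hker : RingHom.ker (ι.stalkMap z).hom ≤ stalkIdeal (vanishingIdeal T) (ι z) := by
    rw [← stalkIdeal_ker_eq_ker_stalkMap]
    exact stalkIdeal_mono hT _
  have hrad : (vanishingIdeal T).radical = vanishingIdeal T := by
    have hs : (vanishingIdeal T).support = T := Closeds.ext (Scheme.IdealSheafData.coe_support_vanishingIdeal (Z := T))
    rw [← Scheme.IdealSheafData.vanishingIdeal_support (I := vanishingIdeal T), hs]
  rw [stalkIdeal_comap_eq_map_stalkMap, ← Ideal.radical_eq_iff, ← Ideal.map_radical_of_surjective hφ hker, ← stalkIdeal_radical, hrad]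

/-- **`𝓘_X(T)·𝒪_S = 𝓘_S(ι⁻¹ T)`** for a closed immersion `ι : S ↪ X` and a closed `T` with `ker ι ≤ 𝓘_X(T)` (i.e. `T ⊆ ι(S)`): the
pulled-back ideal is radical with support `ι⁻¹ T`.  (False without the hypothesis: tangential intersections.) [cite: GortzWedhorn2020, §3.9]
[cite: StacksProject, Tag 01QN] -/
theorem comap_vanishingIdeal_of_isClosedImmersion_of_ker_le (T : Closeds X) (hT : ι.ker ≤ vanishingIdeal T) :
    (vanishingIdeal T).comap ι = vanishingIdeal (T.preimage ι.continuous) := by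
  have hsupp : ((vanishingIdeal T).comap ι).support = T.preimage ι.continuous := by
    ext z
    rw [Scheme.IdealSheafData.support_comap]
    change ι z ∈ ((vanishingIdeal T).support : Set X) ↔ ι z ∈ (T : Set X)
    rw [Scheme.IdealSheafData.coe_support_vanishingIdeal]
  rw [← hsupp, Scheme.IdealSheafData.vanishingIdeal_support]
  refine le_antisymm (Scheme.IdealSheafData.le_radical _) (le_of_forall_stalkIdeal_le fun z => ?_)
  rw [stalkIdeal_radical]
  exact (isRadical_stalkIdeal_comap_vanishingIdeal ι T hT z).radical_le_iff.mpr le_rfl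

/-! ## §2 The third isomorphism: singularities of `T` seen on `S` or on `X` -/

/-- The quotient of `𝒪_{S,z}` by a pulled-back stalk ideal is the quotient of `𝒪_{X,ι z}` by the stalk ideal, when the latter contains the
kernel of the closed immersion (third isomorphism theorem along the surjection `𝒪_{X,ι z} → 𝒪_{S,z}`). [cite: StacksProject, Tag 01QN] -/
theorem nonempty_ringEquiv_quot_comap_of_ker_le (I : X.IdealSheafData) (hI : ι.ker ≤ I) (z : S) :
    Nonempty (((X.presheaf.stalk (ι z)) ⧸ stalkIdeal I (ι z)) ≃+* ((S.presheaf.stalk z) ⧸ stalkIdeal (I.comap ι) z)) := by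
  let φ : X.presheaf.stalk (ι z) →+* S.presheaf.stalk z := (ι.stalkMap z).hom
  have hφ : Function.Surjective φ := ι.stalkMap_surjective z
  let ψ : X.presheaf.stalk (ι z) →+* S.presheaf.stalk z ⧸ stalkIdeal (I.comap ι) z := (Ideal.Quotient.mk _).comp φ
  have hψ : Function.Surjective ψ := Ideal.Quotient.mk_surjective.comp hφ
  have hker : stalkIdeal I (ι z) = RingHom.ker ψ := by
    rw [← RingHom.comap_ker, Ideal.mk_ker, stalkIdeal_comap_eq_map_stalkMap, Ideal.comap_map_of_surjective' _ hφ,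
      ← stalkIdeal_ker_eq_ker_stalkMap, left_eq_sup]
    exact stalkIdeal_mono hI _
  exact ⟨(Ideal.quotEquivOfEq hker).trans (RingHom.quotientKerEquivOfSurjective hψ)⟩

/-- **(T-g)(a) THE SING BRIDGE**: for a closed immersion `ι : S ↪ X` and a closed `T ⊆ ι(S)` (`ker ι ≤ 𝓘_X(T)`), at every `z : S` the local ring
`𝒪_{S,z} ⧸ 𝓘_S(ι⁻¹ T)_z` of `T` seen on `S` is regular iff `𝒪_{X,ι z} ⧸ 𝓘_X(T)_{ι z}` (seen on `X`) is. [cite: StacksProject, Tag 01QN]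
[cite: GortzWedhorn2020, §3.9] -/
theorem isRegularLocalRing_quot_comap_iff (T : Closeds X) (hT : ι.ker ≤ vanishingIdeal T) (z : S) :
    IsRegularLocalRing ((S.presheaf.stalk z) ⧸ stalkIdeal (vanishingIdeal (T.preimage ι.continuous)) z) ↔
      IsRegularLocalRing ((X.presheaf.stalk (ι z)) ⧸ stalkIdeal (vanishingIdeal T) (ι z)) := by
  rw [← comap_vanishingIdeal_of_isClosedImmersion_of_ker_le ι T hT]
  obtain ⟨e⟩ := nonempty_ringEquiv_quot_comap_of_ker_le ι (vanishingIdeal T) hT z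
  constructor
  · intro h
    exact IsRegularLocalRing.of_ringEquiv e.symm
  · intro h
    exact IsRegularLocalRing.of_ringEquiv e

/-! ## §3 The local rings of a closed subscheme -/

/-- **The local ring of the closed subscheme `V(C)` at `z` is regular iff `𝒪_{X,z} ⧸ C_z` is** (`𝒪_{V(C),z} = 𝒪_{X,z} ⧸ C_z`).
[cite: StacksProject, Tag 01QN] -/
theorem isRegularLocalRing_stalk_subscheme_iff {X : Scheme.{u}} (C : X.IdealSheafData) (z : C.subscheme) :
    IsRegularLocalRing (C.subscheme.presheaf.stalk z) ↔
      IsRegularLocalRing ((X.presheaf.stalk (C.subschemeι z)) ⧸ stalkIdeal C (C.subschemeι z)) := by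
  have hker : C.subschemeι.ker ≤ C := (Scheme.IdealSheafData.ker_subschemeι C).le
  obtain ⟨e⟩ := nonempty_ringEquiv_quot_comap_of_ker_le C.subschemeι C hker z
  -- `C·𝒪_{V(C)}` has zero stalks, so the target of `e` is `𝒪_{V(C),z} ⧸ 0 ≅ 𝒪_{V(C),z}`
  have h0 : stalkIdeal (C.comap C.subschemeι) z = ⊥ := by
    rw [stalkIdeal_comap_eq_map_stalkMap, Ideal.map_eq_bot_iff_le_ker, ← stalkIdeal_ker_eq_ker_stalkMap,
      Scheme.IdealSheafData.ker_subschemeι]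
  let e' : ((X.presheaf.stalk (C.subschemeι z)) ⧸ stalkIdeal C (C.subschemeι z)) ≃+* C.subscheme.presheaf.stalk z :=
    (e.trans (Ideal.quotEquivOfEq h0)).trans (RingEquiv.quotientBot _)
  constructor
  · intro h
    exact IsRegularLocalRing.of_ringEquiv e'.symm
  · intro h
    exact IsRegularLocalRing.of_ringEquiv e'

/-- **(T-g)(b) `V(C)_sing` READ ON `X`**: the image in `X` of the non-regular locus of the closed subscheme `V(C)` is
`{y ∈ Supp C | 𝒪_{X,y} ⧸ C_y is not regular}`. [cite: StacksProject, Tag 07R1] [cite: StacksProject, Tag 01QN] -/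
theorem image_compl_regularLocus_subscheme {X : Scheme.{u}} (C : X.IdealSheafData) :
    C.subschemeι '' (Scheme.regularLocus C.subscheme)ᶜ =
      {y | y ∈ (C.support : Set X) ∧ ¬ IsRegularLocalRing ((X.presheaf.stalk y) ⧸ stalkIdeal C y)} := by
  ext y
  constructor
  · rintro ⟨z, hz, rfl⟩
    refine ⟨?_, fun h => hz ((isRegularLocalRing_stalk_subscheme_iff C z).mpr h)⟩
    rw [← Scheme.IdealSheafData.range_subschemeι]
    exact Set.mem_range_self z
  · rintro ⟨hy, hsing⟩
    rw [← Scheme.IdealSheafData.range_subschemeι] at hy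
    obtain ⟨z, rfl⟩ := hy
    exact ⟨z, fun h => hsing ((isRegularLocalRing_stalk_subscheme_iff C z).mp h), rfl⟩

end ContactRealisation

end Summit.ResolutionOfSingularities.ResolutionOfSingularities.Theorems

end
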